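import Literature.Computability.QuantumComplexity.ForrelationDerivativeTables

/-!
# Crux `CubicForrelation.SignedCubicForrelationNotPrBPP` (stmt-QuantumAdvantage-13931)

Stub `stub_dualDistance` of the line `Sketch` (the BAND LEVER, "dual-damage identity").

For a bent Boolean function `b` on `2m` bits with dual `d` — hypothesis
`W_{(-1)^b}(u) = 2^m · (-1)^{d(u)}` for every `u` — and ANY Boolean `a` on `2m` bits,

  `Φ(a, b) = 1 − 2 · #{x : a x ≠ d x} / 2^{2m}`.

Proof (two lines on paper):
`Φ(a,b) = 2^{-3m} · Σ_x (-1)^{a(x)} W_b(x) = 2^{-2m} · Σ_x (-1)^{a(x)} (-1)^{d(x)}`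
and `(-1)^p (-1)^q = 1 − 2·[p ≠ q]`, so the sum is `2^{2m} − 2 · #{x : a x ≠ d x}`.
-/

noncomputable section

set_option linter.dupNamespace false -- D-0017: single-problem summit ⇒ `QuantumAdvantage.QuantumAdvantage` by design

namespace Summit.QuantumAdvantage.QuantumAdvantage.Theorems.SignedCubicForrelationNotPrBPP

open Literature.Computability.QuantumComplexity Literature.Computability.Complexity
open Literature.Computability.QuantumComplexity.BuzetChailloux (bxor zeroVec phi phi_signOf)
open Literature.Computability.QuantumComplexity.DerivativeWalsh (W fsum_eq_sum_mul_W phi_eq_fsum)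

/-- `(-1)^p · (-1)^q = 1 - 2·[p ≠ q]` (sign product as an indicator of disagreement). -/
private theorem stub_dualDistance_signOf_mul_signOf (p q : Bool) :
    signOf p * signOf q = 1 - 2 * (if p ≠ q then (1 : ℝ) else 0) := by
  cases p <;> cases q <;> simp [signOf] <;> norm_num

/-- DUAL-DAMAGE IDENTITY (stub `stub_dualDistance` of line `Sketch`, crux stmt-QuantumAdvantage-13931).
For `b` on `m + m` bits bent with dual `d` (`W_{(-1)^b}(u) = 2^m (-1)^{d(u)}` for all `u`) and every
Boolean `a`: `Φ(a,b) = 1 − 2·#{x : a x ≠ d x}/2^{m+m}`. Proof: `Φ(a,b) = 2^{-3m} Σ_x (-1)^{a x} W_b(x)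
= 2^{-2m} Σ_x (-1)^{a x}(-1)^{d x}` and `(-1)^p(-1)^q = 1 − 2[p ≠ q]`. -/
theorem stub_dualDistance :
    ∀ (m : ℕ) (a b d : (Fin (m + m) → Bool) → Bool),
      (∀ u, W (fun y => signOf (b y)) u = (2 : ℝ) ^ m * signOf (d u)) →
      forrelation a b =
        1 - 2 * ((Finset.univ.filter fun x => a x ≠ d x).card : ℝ) / (2 : ℝ) ^ (m + m) := by
  intro m a b d hbd
  rw [← phi_signOf, phi_eq_fsum, fsum_eq_sum_mul_W]
  have hW : ∀ x, signOf (a x) * W (fun y => signOf (b y)) x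
      = (2 : ℝ) ^ m * (1 - 2 * (if a x ≠ d x then (1 : ℝ) else 0)) := by
    intro x
    rw [hbd x, ← stub_dualDistance_signOf_mul_signOf]
    ring
  simp_rw [hW]
  rw [← Finset.mul_sum, Finset.sum_sub_distrib, ← Finset.mul_sum, Finset.sum_boole]
  have hcard : (∑ _x : Fin (m + m) → Bool, (1 : ℝ)) = (2 : ℝ) ^ (m + m) := by
    simp [Finset.card_univ, Fintype.card_bool, Fintype.card_fin]
  rw [hcard]
  have hsqrt : Real.sqrt ((2 : ℝ) ^ (3 * (m + m))) = (2 : ℝ) ^ m * (2 : ℝ) ^ (m + m) := by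
    have : (2 : ℝ) ^ (3 * (m + m)) = ((2 : ℝ) ^ m * (2 : ℝ) ^ (m + m)) ^ 2 := by
      rw [← pow_add, ← pow_mul]; congr 1; ring
    rw [this, Real.sqrt_sq (by positivity)]
  rw [hsqrt]
  have h2 : (2 : ℝ) ^ m ≠ 0 := pow_ne_zero _ two_ne_zero
  have h4 : (2 : ℝ) ^ (m + m) ≠ 0 := pow_ne_zero _ two_ne_zero
  field_simp

end Summit.QuantumAdvantage.QuantumAdvantage.Theorems.SignedCubicForrelationNotPrBPP

end
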